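/-
Copyright (c) 2026 the pub-hodgecm-mathlib formalisation cell (harness21).  Prover seat hodgecm-mathlib-K2E4-p14 (g9), Track B ∕ K2-LIT, h413 = `stmt-HodgeConjecture-24833`,
route of record `HCCMUnconditional`, campaign 5Res ∕ RUNG 1 (M1 atoms); dealer K2E1-plan (g7) deal (262): THE SINGLE-`(χ, U)` TOP — atoms at ONE `K`-type `(χ₀, U₀)` ⟹ the
`(χ₀, U₀)`-part of `L²_res` is finite-dimensional (★ `levelFinite_of_atoms`'s per-`(χ, U)` step extracted; generic `𝒢`).
-/
import Summits.HodgeConjecture.HodgeConjecture.Theorems.K2E1ResidualLevelFiniteOfAtomsU   -- ★ p860390 (this seat): `mem_of_mem_topologicalClosure_biSup`, `levelFinite_of_atoms`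
import HarnessLib

/-!
# h413 ∕ Track B «K2-LIT», RUNG 1 — `K2E1ResidualPartFiniteOfAtomsAtU`: ATOMS AT ONE `K`-TYPE `(χ₀, U₀)` ⟹ `(L²_res)^{(χ₀, U₀)}` IS FINITE-DIMENSIONAL (generic `𝒢`; the top of
# the M1 atoms theorem «`(L²_res(U(1,1)_{L∕L⁺}))^{K_∞·K_max,f}` is finite-dimensional»)

Cell `pub/hodgecm-mathlib`, crux H413 = `stmt-HodgeConjecture-24833`; dealer K2E1-plan (g7) (262).  THEOREMS ONLY (no `def`, no `instance`, no `notation`, no named-fact hypothesis,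
no `sorry`); lane `--kind proof --supports stmt-HodgeConjecture-24833 --as helper` (count-neutral, closes no socket).

THE MATHEMATICS [MoeglinWaldspurger1995, I.2.18, V.3.13] [HarishChandra1968, Thm. 1] [BorelJacquet1979, §4.6] [Dixmier1977, §13.1].  Data: `ιK : K →* G(𝔸)`, `ιa : T →* K`,
`ιf : K_f →* K`, ONE `K`-type `(χ₀ : T →* ℂ, U₀ ≤ K_f open)`, and the ATOMS AT `(χ₀, U₀)` — a continuous linear `P` on `L²` fixing every `x` with `R(ιK ιf u) x = x` (`u ∈ U₀`),
`R(ιK ιa t) x = χ₀ t • x` (in print `P = R(e_{χ₀} ⊗ e_{U₀})`), and a finite-dimensional `A ≤ L²` with `P(W) ⊆ A` for every topologically irreducible closed `W ≤ L²_res` (★ K2E4-p23's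
`hatoms_of_letters` output at `(χ₀, U₀)`).  Since `L²_res = closure ⨆ W` over those `W` (★ D5′-pre `residualSubspace_eq_iSupClosure`), `P` maps `L²_res` into `closure A = A`; a vector of
the joint `(χ₀, U₀)`-eigenspace of `L²_res` is fixed by `P`, hence lies in `A`: the eigenspace embeds in `A` and is finite-dimensional (§1).  §2: the trivial `K_∞`-type (`χ₀ = 1`) — the
`(ιa(T)·ιf(U₀))`-INVARIANTS of `L²_res` are finite-dimensional (★ `levelFinite_of_atoms` is §1 at every `(χ, U)`).  The `cmDatum L 2 J₂` print at
`(1, K_max,f)` (RUNG 1 by name) follows in the CM file once K2E4-p23's `K2E1ResidualAtomsMaximalLevelCMTwo` is ★.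
HONEST LABEL: HC_CM is proved only modulo the 7 printed citations (2 remaining named inputs: hLiu418 = `stmt-HodgeConjecture-24832`, h413 = `stmt-HodgeConjecture-24833`) until rung 0
closes; RUNG 1 (M1 atoms) ≠ 5Res (all `(U, τ)`); count-neutral helper, asserts no named fact, closes no socket.

## References
* [MoeglinWaldspurger1995] C. Mœglin, J.-L. Waldspurger, *Spectral Decomposition and Eisenstein Series* (1995), I.2.18, V.3.13.
* [HarishChandra1968] Harish-Chandra, *Automorphic Forms on Semisimple Lie Groups*, LNM 62 (1968), Thm. 1.
* [BorelJacquet1979] A. Borel, H. Jacquet, *Automorphic forms and automorphic representations*, Corvallis I (1979), §4.6.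
* [Dixmier1977] J. Dixmier, *C\*-Algebras* (1977), §13.1.
-/

set_option autoImplicit false
-- the mandated namespace repeats the single-problem summit's segment (`HodgeConjecture.HodgeConjecture`)
set_option linter.dupNamespace false

noncomputable section

open MeasureTheory Filter Topology Set
open Literature.NumberTheory.Automorphic ContRepresentation
open Summit.HodgeConjecture.HodgeConjecture.Cruxes.H413.K2E1CuspidalSpectrumUnitary
open Summit.HodgeConjecture.HodgeConjecture.Cruxes.H413.K2E1ResidualPartSpanIrreduciblesU (residualSubspace_eq_iSupClosure)
open Summit.HodgeConjecture.HodgeConjecture.Cruxes.H413.K2E1ResidualLevelFiniteOfAtomsU (mem_of_mem_topologicalClosure_biSup)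

namespace Summit.HodgeConjecture.HodgeConjecture.Cruxes.H413.K2E1ResidualPartFiniteOfAtomsAtU

universe u

variable {F : Type} [Field F] [NumberField F] (𝒢 : AdelicGroupData.{u} F) (μ : Measure 𝒢.automorphicQuotient) [𝒢.IsAutomorphicMeasure μ]
  (𝔓 : 𝒢.ParabolicUnipotentData)

/-! ## §1 HEAD: atoms at ONE `(χ₀, U₀)` ⟹ the `(χ₀, U₀)`-eigenspace of `L²_res` is finite-dimensional -/

/-- **ATOMS AT `(χ₀, U₀)` ⟹ `(L²_res)^{(χ₀, U₀)}` IS FINITE-DIMENSIONAL** (generic `𝒢`; ★ `levelFinite_of_atoms`'s per-`(χ, U)` step).  `hatoms₀` is ★ K2E4-p23's `hatoms_of_letters`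
output at ONE `K`-type: `∃ P A, dim A < ∞ ∧ (P` fixes the `(χ₀, U₀)`-vectors`) ∧ (P` maps every irreducible closed `W ≤ L²_res` into `A)`.  CONCLUSION: the joint eigenspace
`(⨅_{u ∈ U₀} ker(σ(ιf u) − 1)) ⊓ ⨅_t ker(σ(ιa t) − χ₀ t)` of `σ := R|_{L²_res} ∘ ιK` is finite-dimensional (it embeds in `A`: ★ `residualSubspace_eq_iSupClosure` + ★
`mem_of_mem_topologicalClosure_biSup`). [cite: MoeglinWaldspurger1995, I.2.18 and V.3.13] [cite: HarishChandra1968, Thm. 1] [cite: BorelJacquet1979, §4.6] -/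
theorem eigenspace_finiteDimensional_of_atoms_at
    {K : Type*} [Group K] (ιK : K →* 𝒢.Adelic) {T : Type*} [Group T] (ιa : T →* K) {Kf : Type*} [Group Kf] [TopologicalSpace Kf] (ιf : Kf →* K)
    (χ₀ : T →* ℂ) (U₀ : OpenSubgroup Kf)
    (hatoms₀ : ∃ (P : 𝒢.L2 μ →L[ℂ] 𝒢.L2 μ) (A : Submodule ℂ (𝒢.L2 μ)), FiniteDimensional ℂ A ∧
      (∀ x : 𝒢.L2 μ, (∀ u ∈ U₀, 𝒢.rightRegular μ (ιK (ιf u)) x = x) → (∀ t : T, 𝒢.rightRegular μ (ιK (ιa t)) x = χ₀ t • x) → P x = x) ∧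
      ∀ W : ClosedSubrep (𝒢.rightRegular μ), W.toContRep.IsTopIrreducible → W ≤ residualSubspace 𝒢 μ 𝔓 → ∀ w ∈ W, P w ∈ A) :
    FiniteDimensional ℂ ↥((⨅ u : U₀, Module.End.eigenspace ((((residualSubspace 𝒢 μ 𝔓).toContRep.restrict ιK) (ιf (u : Kf))).toLinearMap) 1) ⊓
      ⨅ t : T, Module.End.eigenspace ((((residualSubspace 𝒢 μ 𝔓).toContRep.restrict ιK) (ιa t)).toLinearMap) (χ₀ t)) := by
  obtain ⟨P, A, hAfd, hPfix, hPW⟩ := hatoms₀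
  haveI := hAfd
  set J : Submodule ℂ (residualSubspace 𝒢 μ 𝔓).toSubmodule :=
    (⨅ u : U₀, Module.End.eigenspace ((((residualSubspace 𝒢 μ 𝔓).toContRep.restrict ιK) (ιf (u : Kf))).toLinearMap) 1) ⊓
      ⨅ t : T, Module.End.eigenspace ((((residualSubspace 𝒢 μ 𝔓).toContRep.restrict ιK) (ιa t)).toLinearMap) (χ₀ t) with hJ
  -- the irreducible `W ⊥ L²_cusp` lie in `L²_res` (★ D5′-pre), so `P` maps them into `A`
  have hPW' : ∀ W ∈ {W : ClosedSubrep (𝒢.rightRegular μ) | W.toContRep.IsTopIrreducible ∧ W ≤ (𝒢.cuspidalSubspace μ 𝔓).orthogonal (𝒢.isUnitary_rightRegular μ)},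
      ∀ w ∈ W.toSubmodule, P w ∈ A := fun W hW w hw =>
    hPW W hW.1 (by rw [residualSubspace_eq_iSupClosure]; exact ClosedSubrep.le_iSupClosure hW) w hw
  -- every vector of the joint eigenspace lies (as a vector of `L²`) in the atom `A`
  have hJA : ∀ y : (residualSubspace 𝒢 μ 𝔓).toSubmodule, y ∈ J → (y : 𝒢.L2 μ) ∈ A := by
    intro y hy
    obtain ⟨hyU, hyT⟩ := Submodule.mem_inf.1 hy
    have h1 : ∀ u ∈ U₀, 𝒢.rightRegular μ (ιK (ιf u)) (y : 𝒢.L2 μ) = y := fun u hu => by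
      have h := (Submodule.mem_iInf _).1 hyU ⟨u, hu⟩
      rw [Module.End.mem_eigenspace_iff, one_smul] at h
      exact congrArg Subtype.val h
    have h2 : ∀ t : T, 𝒢.rightRegular μ (ιK (ιa t)) (y : 𝒢.L2 μ) = χ₀ t • (y : 𝒢.L2 μ) := fun t => by
      have h := (Submodule.mem_iInf _).1 hyT t
      rw [Module.End.mem_eigenspace_iff] at h
      exact congrArg Subtype.val h
    have hPy : P (y : 𝒢.L2 μ) = y := hPfix _ h1 h2
    have hyres : (y : 𝒢.L2 μ) ∈ ClosedSubrep.iSupClosure {W : ClosedSubrep (𝒢.rightRegular μ) |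
        W.toContRep.IsTopIrreducible ∧ W ≤ (𝒢.cuspidalSubspace μ 𝔓).orthogonal (𝒢.isUnitary_rightRegular μ)} :=
      (residualSubspace_eq_iSupClosure 𝒢 μ 𝔓).le y.2
    exact mem_of_mem_topologicalClosure_biSup {W : ClosedSubrep (𝒢.rightRegular μ) | W.toContRep.IsTopIrreducible ∧ W ≤ (𝒢.cuspidalSubspace μ 𝔓).orthogonal (𝒢.isUnitary_rightRegular μ)}
      (fun W => W.toSubmodule) P A hPW' hyres hPy
  -- hence the joint eigenspace embeds linearly into `A`
  let φ : J →ₗ[ℂ] A := LinearMap.codRestrict A ((residualSubspace 𝒢 μ 𝔓).toSubmodule.subtype ∘ₗ J.subtype) fun y => hJA y.1 y.2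
  refine FiniteDimensional.of_injective φ fun a b hab => ?_
  have h := congrArg Subtype.val hab
  exact Subtype.ext (Subtype.ext h)

/-! ## §2 The trivial `K_∞`-type: the `(ιa(T)·ιf(U₀))`-invariants of `L²_res` -/

/-- **ATOMS AT `(1, U₀)` ⟹ THE `(ιa(T)·ιf(U₀))`-INVARIANTS OF `L²_res` ARE FINITE-DIMENSIONAL** — §1 at the trivial character `χ₀ = 1` (`1 • x = x`): the shape of RUNG 1
«`(L²_res)^{K_∞·K_max,f}` finite-dimensional» (CM print at `(1, K_max,f)` in the CM file). [cite: MoeglinWaldspurger1995, I.2.18 and V.3.13] [cite: HarishChandra1968, Thm. 1] -/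
theorem invariants_finiteDimensional_of_atoms_at_one
    {K : Type*} [Group K] (ιK : K →* 𝒢.Adelic) {T : Type*} [Group T] (ιa : T →* K) {Kf : Type*} [Group Kf] [TopologicalSpace Kf] (ιf : Kf →* K) (U₀ : OpenSubgroup Kf)
    (hatoms₀ : ∃ (P : 𝒢.L2 μ →L[ℂ] 𝒢.L2 μ) (A : Submodule ℂ (𝒢.L2 μ)), FiniteDimensional ℂ A ∧
      (∀ x : 𝒢.L2 μ, (∀ u ∈ U₀, 𝒢.rightRegular μ (ιK (ιf u)) x = x) → (∀ t : T, 𝒢.rightRegular μ (ιK (ιa t)) x = x) → P x = x) ∧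
      ∀ W : ClosedSubrep (𝒢.rightRegular μ), W.toContRep.IsTopIrreducible → W ≤ residualSubspace 𝒢 μ 𝔓 → ∀ w ∈ W, P w ∈ A) :
    FiniteDimensional ℂ ↥((⨅ u : U₀, Module.End.eigenspace ((((residualSubspace 𝒢 μ 𝔓).toContRep.restrict ιK) (ιf (u : Kf))).toLinearMap) 1) ⊓
      ⨅ t : T, Module.End.eigenspace ((((residualSubspace 𝒢 μ 𝔓).toContRep.restrict ιK) (ιa t)).toLinearMap) 1) := by
  obtain ⟨P, A, hAfd, hPfix, hPW⟩ := hatoms₀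
  have h := eigenspace_finiteDimensional_of_atoms_at 𝒢 μ 𝔓 ιK ιa ιf (1 : T →* ℂ) U₀
    ⟨P, A, hAfd, fun x hU hT => hPfix x hU fun t => by rw [hT t, MonoidHom.one_apply, one_smul], hPW⟩
  simpa only [MonoidHom.one_apply] using h

end Summit.HodgeConjecture.HodgeConjecture.Cruxes.H413.K2E1ResidualPartFiniteOfAtomsAtU

end
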